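import Summits.CriticalPhenomena.SAWScalingLimit.Theses.SAWTrackTransport
import Summits.CriticalPhenomena.SAWScalingLimit.Theses.SAWIsotropicAnchor
import Literature.Probability.RandomPlanarGeometry.RestrictionPullback
import Literature.Probability.RandomPlanarGeometry.HullApproximation
import Literature.Probability.RandomPlanarGeometry.ConformalRestrictionProofs
import Literature.Probability.RandomPlanarGeometry.ConformalMapCaratheodoryProofs
import Literature.Topology.PlaneTopology.EilenbergCriterion

/-!
# Line `scale-mixing` for crux `RStarRot` (stmt-CriticalPhenomena-7298), routes SAWTrackTransport (r5) /
SAWIsotropicAnchor (r3) — strategist's ALTERNATIVE to line `birth`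

**Idea (LSW in every chart, by mixing).** Pull each law `P D` back to `(ℍ; 0, ∞)` along a chordal
uniformizing map `φ` (`ChordalFamily.pullbackLaw`, tree). In the tree's PROVED Lawler–Schramm–Werner
pipeline (`exists_isRestrictionMeasure_of_isHullMultiplicative_holds` = [LSW03] Prop. 3.3,
`IsRestrictionMeasure.eq_five_eighths_of_outer_simple_holds` = p. 5 result 2) conformal covariance of
the family is consumed in exactly TWO places: (i) SCALE INVARIANCE of the chart law — which only needs
covariance of `P D` under the conformal automorphisms of `(D; a, b)` (the hyperbolic one-parameter
group; `isScaleInvariant_pullbackLaw` instantiates covariance at `(D, D, φ ∘ (r·) ∘ φ⁻¹)` only), and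
(ii) TRANSPORT between `D` and its hull subdomains `D_J = φ(ℍ ∖ J)` inside
`pullbackLaw_avoid_hullProduct` (carving covariance ⇒ hull multiplicativity).

The line replaces (ii) by a MIXING ARGUMENT that uses (i) at `D` and at `D_J` plus a 0–1 LAW for the
germ of the curve at the marked point `a`:
`μ_J(avoid A) = μ_J(avoid rA) = μ(avoid J ∩ avoid Φ_J⁻¹(rA)) / μ(avoid J)` for every `r > 0`
(scale invariance of `μ_J := pullbackLaw P D_J`, restriction); as `r → 0⁺` the hull `Φ_J⁻¹(rA)`
is squeezed between `(r/Φ_J'(0))·A∓` and shrinks into `0`, so by backward-martingale convergence on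
the (trivial) germ σ-field and scale invariance of `μ := pullbackLaw P D` the right-hand side tends to
`μ(avoid A)` (touching of pulled-back Jordan hulls is null by boundary avoidance in the subdomain,
`ae_mem_chordalCarrier_of_rangeSubset`). Hence every chart law is scale invariant AND arc-hull
multiplicative, hence (`IsArcHullMultiplicative.isHullMultiplicative`, Prop. 3.3, 5/8) equal to
`P_{5/8}`, hence all chart laws of all domains coincide and the family is conformally covariant
(transport back by `ext_of_missCode_injOn` as in `RestrictionUniqueness` / `AvoidanceDeterminesLaw`).

Stubs (2 open + 2 provable-now):
* `stub_internalScaleInvariance` (OPEN; "the Möbius step for every D"): under the R*_rot axioms each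
  `P D` is invariant under `Aut(D; a, b)` pushed through any continuous plane extension — the crux's
  conclusion specialised to `D' = D`. This is where the MARKOV kernel clause and ROTATION covariance
  must bite: the Gibbs tilts `F·SLE/Z` (refuter attack c1, A5), the chord-aligned stretches
  `(L_{arg(b−a)})_* SLE` and Beffara's `L_* SLE` all satisfy the remaining axioms and all FAIL this stub.
* `stub_germZeroOne` (OPEN; Blumenthal-type 0–1 law): under the R*_rot axioms, for every `D` the germ
  σ-field of the trace at `a = D.pt 0` is `P D`-trivial. Necessary (SLE_{8/3} satisfies it); carries the
  "no hidden label / no choice-built memory" content; attack: a non-trivial germ makes `P` a Bayesian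
  mixture over (a,b)-domains, and Bayes weights are inconsistent around LOOPS of the restriction poset.
* `stub_chartMultiplicative` (provable, L): chordal + hull restriction + simple carriers + the two
  conclusions above ⇒ every pullback law is scale invariant and arc-hull multiplicative (the mixing
  argument; inputs all in `RestrictionPullback` / `RestrictionCovariance` / `HullApproximation`).
* `stub_chartRigidity` (provable from the tree, M–L): chordal + hull restriction + simple carriers +
  (scale invariant ∧ arc-hull multiplicative pullback laws) ⇒ `IsConformallyCovariant` (Prop. 3.3 ⇒
  `P_α`, simple ⇒ `α = 5/8`, uniqueness of `P_{5/8}`, transport back along `exists_continuousMap_conj`).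

`RStarRot_of` concludes `…Theses.SAWTrackTransport.RStarRot` BY NAME (real proof: the stubs composed
with the tree lemmas `IsRestrictionMarkov.isRestriction`, `IsRestriction.isHullRestriction`);
`RStarRot_of_isotropicAnchor` is the same term for the shared copy in route SAWIsotropicAnchor.
Differs from `birth` at the cut: birth = Möbius invariance of ONE law (disc) + ∃-uniformizer transport
for every `D` (shape independence assumed); here shape independence is DERIVED from internal scale
invariance + a 0–1 law through proved LSW technology.
-/

namespace Summit.CriticalPhenomena.SAWScalingLimit.Cruxes.RStarRot.ScaleMixing


/-- stub 1 (OPEN; internal scale invariance = the Möbius step for every domain): under the R*_rot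
axioms verbatim, every law `P D` is invariant under every conformal automorphism `g` of `D` with
boundary values `a ↦ a`, `b ↦ b`, pushed forward along any continuous plane map `Φ` agreeing with `g`
on `D` — the crux's conclusion `IsConformallyCovariant` specialised to `D' = D`. In the half-plane
chart this is dilation invariance of the pull-back law (`RestrictionConfig.IsScaleInvariant`). -/
theorem stub_internalScaleInvariance : ∀ P : Literature.Probability.RandomPlanarGeometry.ChordalFamily, P.IsChordal → P.IsRestrictionMarkov → P.IsReversible → P.IsSimilarityCovariant → (∀ D : Literature.Probability.RandomPlanarGeometry.DobrushinDomain, P (D.map Complex.conjLIE.toHomeomorph) = (P D).map (Literature.Probability.RandomPlanarGeometry.CurveClass.map (Complex.conjLIE.toHomeomorph : C(ℂ, ℂ)))) → (∀ D : Literature.Probability.RandomPlanarGeometry.DobrushinDomain, ∀ᵐ γ ∂(P D), γ ∈ Literature.Probability.RandomPlanarGeometry.CurveClass.simple ∧ γ.range ∩ frontier D.carrier ⊆ {D.pt 0, D.pt 1}) → ∀ (D : Literature.Probability.RandomPlanarGeometry.DobrushinDomain) (g : Literature.Probability.RandomPlanarGeometry.ConformalEquiv D.carrier D.carrier) (Φ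 : C(ℂ, ℂ)), g.HasBoundaryValue (D.pt 0) (D.pt 0) → g.HasBoundaryValue (D.pt 1) (D.pt 1) → Set.EqOn Φ g D.carrier → P D = (P D).map (Literature.Probability.RandomPlanarGeometry.CurveClass.map Φ) := by
  sorry

/-- stub 2 (OPEN; 0–1 law for the germ at the first marked point): under the R*_rot axioms verbatim,
for every Dobrushin domain `(D; a, b)` every event in the GERM σ-FIELD of the trace at `a` — the
intersection over `ε > 0` of the σ-fields generated by the events "the trace avoids `F`", `F` closed,
`F ⊆ closedBall a ε` — has `P D`-probability `0` or `1`. (For SLE_{8/3}: Blumenthal's 0–1 law for the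
driving Brownian motion; simple transient traces visit a neighbourhood of `a` only at the start.) -/
theorem stub_germZeroOne : ∀ P : Literature.Probability.RandomPlanarGeometry.ChordalFamily, P.IsChordal → P.IsRestrictionMarkov → P.IsReversible → P.IsSimilarityCovariant → (∀ D : Literature.Probability.RandomPlanarGeometry.DobrushinDomain, P (D.map Complex.conjLIE.toHomeomorph) = (P D).map (Literature.Probability.RandomPlanarGeometry.CurveClass.map (Complex.conjLIE.toHomeomorph : C(ℂ, ℂ)))) → (∀ D : Literature.Probability.RandomPlanarGeometry.DobrushinDomain, ∀ᵐ γ ∂(P D), γ ∈ Literature.Probability.RandomPlanarGeometry.CurveClass.simple ∧ γ.range ∩ frontier D.carrier ⊆ {D.pt 0, D.pt 1}) → ∀ (D : Literature.Probability.RandomPlanarGeometry.DobrushinDomain) (S : Set (Literature.Probability.RandomPlanarGeometry.CurveClass ℂ)), @MeasurableSet (Literature.Probability.RandomPlanarGeometry.CurveClass ℂ) (⨅ (ε : ℝ) (_ : 0 < ε), MeasurableSpace.generateFrom {T : Set (Literature.Probability.RandomPlanarGeometry.CurveClass ℂ) | ∃ F : Set ℂ, IsClosed F ∧ F ⊆ Metric.closedBall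 (D.pt 0) ε ∧ T = Literature.Probability.RandomPlanarGeometry.CurveClass.rangeSubset Fᶜ}) S → P D S = 0 ∨ P D S = 1 := by
  sorry

/-- stub 3 (provable now, size L; the mixing argument): for a chordal family with two-sided
restriction over hull subdomains, carried by simple boundary-avoiding curves, INTERNAL SCALE
INVARIANCE (conclusion of stub 1) and the GERM 0–1 LAW at `a` (conclusion of stub 2) make every
pull-back law `pullbackLaw P D φ` (i) scale invariant — the tree's `isScaleInvariant_pullbackLaw` with
the covariance step replaced by stub 1 at `(D, D, φ ∘ (r·) ∘ φ⁻¹)` via `exists_continuousMap_conj` —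
and (ii) arc-hull multiplicative: with `J` an arc-hull, `D_J` its Jordan hull subdomain
(`exists_isHullSubdomain_pullbackHull_eq`) and `μ_J` the pull-back law of `D_J`, restriction gives
`μ(avoid A·J) = μ_J(avoid A) μ(avoid J)` (Step 1–2 of `pullbackLaw_avoid_hullProduct`, no covariance
used), and `μ_J(avoid A) = μ_J(avoid rA) = μ(avoid J ∩ avoid Φ_J⁻¹(rA))/μ(avoid J) → μ(avoid A)` as
`r → 0⁺` by backward-martingale convergence on the trivial germ σ-field, the squeeze
`(r/Φ_J'(0))A⁻ ⊆ Φ_J⁻¹(rA) ⊆ (r/Φ_J'(0))A⁺`, scale invariance of `μ`, and null touching of pulled-back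
Jordan hulls (`ae_mem_chordalCarrier_of_rangeSubset`). -/
theorem stub_chartMultiplicative : ∀ P : Literature.Probability.RandomPlanarGeometry.ChordalFamily, P.IsChordal → P.IsHullRestriction → P.IsCarriedBySimpleCurves → (∀ (D : Literature.Probability.RandomPlanarGeometry.DobrushinDomain) (g : Literature.Probability.RandomPlanarGeometry.ConformalEquiv D.carrier D.carrier) (Φ : C(ℂ, ℂ)), g.HasBoundaryValue (D.pt 0) (D.pt 0) → g.HasBoundaryValue (D.pt 1) (D.pt 1) → Set.EqOn Φ g D.carrier → P D = (P D).map (Literature.Probability.RandomPlanarGeometry.CurveClass.map Φ)) → (∀ (D : Literature.Probability.RandomPlanarGeometry.DobrushinDomain) (S : Set (Literature.Probability.RandomPlanarGeometry.CurveClass ℂ)), @MeasurableSet (Literature.Probability.RandomPlanarGeometry.CurveClass ℂ) (⨅ (ε : ℝ) (_ : 0 < ε), MeasurableSpace.generateFrom {T : Set (Literature.Probability.RandomPlanarGeometry.CurveClass ℂ) | ∃ F : Set ℂ, IsClosed F ∧ F ⊆ Metric.closedBall (D.pt 0) ε ∧ T = Literature.Probability.RandomPlanarGeometry.CurveClass.rangeSubset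 Fᶜ}) S → P D S = 0 ∨ P D S = 1) → ∀ (D : Literature.Probability.RandomPlanarGeometry.DobrushinDomain) (φ : Literature.Probability.RandomPlanarGeometry.ConformalEquiv UpperHalfPlane.upperHalfPlaneSet D.carrier) (hφ : D.IsChordalUniformizing φ), Literature.Probability.RandomPlanarGeometry.RestrictionConfig.IsScaleInvariant (Literature.Probability.RandomPlanarGeometry.ChordalFamily.pullbackLaw P D φ Literature.Topology.PlaneTopology.JordanArcSeparation_holds Literature.Probability.RandomPlanarGeometry.JordanDomain.exists_continuousOn_extension_holds hφ) ∧ Literature.Probability.RandomPlanarGeometry.RestrictionConfig.IsArcHullMultiplicative (Literature.Probability.RandomPlanarGeometry.ChordalFamily.pullbackLaw P D φ Literature.Topology.PlaneTopology.JordanArcSeparation_holds Literature.Probability.RandomPlanarGeometry.JordanDomain.exists_continuousOn_extension_holds hφ) := by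
  sorry

/-- stub 4 (provable now from the tree, size M–L; LSW in every chart): a chordal family with
two-sided restriction over hull subdomains, carried by simple boundary-avoiding curves, ALL of whose
pull-back laws are scale invariant and arc-hull multiplicative is conformally covariant. Proof plan:
`IsArcHullMultiplicative.isHullMultiplicative` (facts `exists_antitone_isArcHull`,
`exists_isHullProduct_plus_minus`, `existsUnique_isRestrictionMap`, all with `_holds` companions used by
`LawlerSchrammWerner2003_unique_holds`), `exists_isRestrictionMeasure_of_isHullMultiplicative_holds`
(Prop. 3.3) and `eq_five_eighths_of_outer_simple_holds` (pull-back configurations are simple paths,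
`isSimplePath_pullbackConfig`) make every pull-back law THE restriction measure `P_{5/8}`
(`IsRestrictionMeasure.unique`); for `g : D → D'` with boundary values and plane extension `Φ`, the
laws `P D'` and `(P D).map (CurveClass.map Φ)` are carried by `chordalCarrier D'`
(`map_mem_chordalCarrier`) and have the same pull-back law along a chart `ψ` of `D'` (the pull-back of
the image law along `ψ` is the pull-back of `P D` along the chart `g⁻¹ ∘ ψ` of `D`, cf. the proof of
`pullbackLaw_eq_of_covariant`), hence the same avoidance probabilities of image test sets, hence are
equal (`CurveClass.Measure.ext_of_missCode_injOn` with `injOn_missCode_imageTest`, as in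
`RestrictionUniqueness` / `AvoidanceDeterminesLaw_proof`). -/
theorem stub_chartRigidity : ∀ P : Literature.Probability.RandomPlanarGeometry.ChordalFamily, P.IsChordal → P.IsHullRestriction → P.IsCarriedBySimpleCurves → (∀ (D : Literature.Probability.RandomPlanarGeometry.DobrushinDomain) (φ : Literature.Probability.RandomPlanarGeometry.ConformalEquiv UpperHalfPlane.upperHalfPlaneSet D.carrier) (hφ : D.IsChordalUniformizing φ), Literature.Probability.RandomPlanarGeometry.RestrictionConfig.IsScaleInvariant (Literature.Probability.RandomPlanarGeometry.ChordalFamily.pullbackLaw P D φ Literature.Topology.PlaneTopology.JordanArcSeparation_holds Literature.Probability.RandomPlanarGeometry.JordanDomain.exists_continuousOn_extension_holds hφ) ∧ Literature.Probability.RandomPlanarGeometry.RestrictionConfig.IsArcHullMultiplicative (Literature.Probability.RandomPlanarGeometry.ChordalFamily.pullbackLaw P D φ Literature.Topology.PlaneTopology.JordanArcSeparation_holds Literature.Probability.RandomPlanarGeometry.JordanDomain.exists_continuousOn_extension_holds hφ)) → P.IsConformallyCovariant := by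
  sorry

/-- Assembly (real proof, no `sorry` of its own): the crux hypotheses give hull restriction
(`IsRestrictionMarkov.isRestriction`, `IsRestriction.isHullRestriction`) and simple carriers
(definitionally `IsCarriedBySimpleCurves`); stubs 1 and 2 feed stub 3, whose conclusion feeds stub 4.
Concludes the route decl `…Theses.SAWTrackTransport.RStarRot` BY NAME. -/
theorem RStarRot_of : Summit.CriticalPhenomena.SAWScalingLimit.Theses.SAWTrackTransport.RStarRot := by
  intro P hch hmk hrev hsim hconj hsimple
  have hres : P.IsHullRestriction := hmk.isRestriction.isHullRestriction
  have hS : P.IsCarriedBySimpleCurves := hsimple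
  exact stub_chartRigidity P hch hres hS
    (stub_chartMultiplicative P hch hres hS
      (stub_internalScaleInvariance P hch hmk hrev hsim hconj hsimple)
      (stub_germZeroOne P hch hmk hrev hsim hconj hsimple))

/-- The same assembly for the shared copy of the crux in route SAWIsotropicAnchor (item
stmt-CriticalPhenomena-7298 is ONE item wanted by both routes; identical bodies). Real proof, no
`sorry` of its own; stubs used BY NAME. -/
theorem RStarRot_of_isotropicAnchor : Summit.CriticalPhenomena.SAWScalingLimit.Theses.SAWIsotropicAnchor.RStarRot := by
  intro P hch hmk hrev hsim hconj hsimple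
  have hres : P.IsHullRestriction := hmk.isRestriction.isHullRestriction
  have hS : P.IsCarriedBySimpleCurves := hsimple
  exact stub_chartRigidity P hch hres hS
    (stub_chartMultiplicative P hch hres hS
      (stub_internalScaleInvariance P hch hmk hrev hsim hconj hsimple)
      (stub_germZeroOne P hch hmk hrev hsim hconj hsimple))

end Summit.CriticalPhenomena.SAWScalingLimit.Cruxes.RStarRot.ScaleMixing
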